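import Summits.MatrixMultiplication.MatrixMultiplication.Theorems.FarEdgeDescentTailShadow
import Literature.NumberTheory.LFunctions.DirichletLTruncationWeightBounds
import Mathlib.Analysis.SpecialFunctions.Pow.Asymptotics
import HarnessLib

/-!
# FarEdgeDescent — FAR-TAIL FREEDOM (III): theorem-compatible worlds on demand; the power family

Continuation of `FarEdgeDescentTailFreedom` / `FarEdgeDescentTailShadow`.  Two things.

§3 THEOREM-COMPATIBILITY is a property of the far tail ALONE.  For a free tail `e` (convex, antitone, `≥ 0`,
cube-line coupled) the fold-shadow world `W_F` passes the lineage's three standing checks as soon as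
`e ≤ 1/6` on `[1,∞)` and `inf e = 0`: the VXXZ/Le Gall table (all 24 rows), `W(1,1/3,5/3) = 8/3`, and the
Coppersmith tight shapes `∀ t < 1 ∃ r, W(1,t,r) = 1+r` (`foldShadow_table`, `foldShadow_eightThirds`,
`foldShadow_tight`); the landed far-edge rate `LogRate` passes iff `e(k) ≤ log 2/log(2k+2)` (`foldShadow_logRate`).
(The tight shapes are what force `inf e = 0`; the table only sees `e ≤ 1/6`.)

§4 THE POWER FAMILY `e(x) = c·x^{−δ}` (`δ > 0`, `0 ≤ c`, `c(1+3δ) ≤ 1`) is free (`power_free`: the coupling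
`c(1+3δ) ≤ 1` IS the cube line, via Bernoulli `1 − x^{−δ} ≤ δ(x−1)`), so `powerWorld` is a 3D-LAWFUL world with
far pencil `k + 1 + c·k^{−δ}` and `ω_W = 2 + c` EXPLICIT; it is table/8⁄3/tight-compatible for `c ≤ 1/6`
(`powerWorld_compat`) and `LogRate`-compatible for `c(1 + 2δ·log 2) ≤ δ·log 2` (`powerWorld_logRate`); its leaf
shapes (`powerWorld_shapes`, `c > 0`): NO saturated square shape (`¬FiniteSaturation`-shape),
`PowerAmortisation`-shape with exponent exactly `δ`, `AnchoredLogConvexity`-shape (`⟺ (m−1)² ≥ 0`).  Hence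
3D-lawful, theorem-compatible separating worlds for EVERY rung `δ` of the power ladder — the critic's g26
condition `(ω_W − 2)(1+3δ) ≤ 1` recovered as the square coupling, with `ω_W = 2 + c` stated.  (`δ = 1`,
`c = 1/6` reproduces the rate class of `W_hyp`; `δ > 1` gives integrable excess without saturation.)
-/

set_option linter.dupNamespace false

noncomputable section

namespace Summit.MatrixMultiplication.MatrixMultiplication.Theorems.FarEdgeDescentTailWorlds

open Literature.Computability.AlgebraicComplexity Set Filter Topology
open Summit.MatrixMultiplication.MatrixMultiplication.Theorems.FarEdgeDescentPencilRealisability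
open Summit.MatrixMultiplication.MatrixMultiplication.Theorems.FarEdgeDescentTailFreedom
open Summit.MatrixMultiplication.MatrixMultiplication.Theorems.FarEdgeDescentTailShadow

/-! ## §3 Theorem-compatibility of the fold-shadow world of a small free tail -/

section Compat

variable {e F : ℝ → ℝ} {W : ℝ → ℝ → ℝ → ℝ}
  (hconv : ConvexOn ℝ (Ici 1) e) (hanti : AntitoneOn e (Ici 1)) (hnn : ∀ x : ℝ, 1 ≤ x → 0 ≤ e x)
  (hcube : ∀ x : ℝ, 1 ≤ x → e 1 - e x ≤ (1 - e 1) / 3 * (x - 1))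
  (hF : ∀ x : ℝ, F x = if 1 ≤ x then x + 1 + e x
    else max 2 ((3 + x) / 2 + (1 + x) / 2 * e (2 / (1 + x))))
  (hW : ∀ a b c : ℝ, W a b c = max ((a + c) / 2 * F (2 * b / (a + c)))
    (max ((a + b) / 2 * F (2 * c / (a + b))) ((b + c) / 2 * F (2 * a / (b + c)))))
  (hsmall : ∀ x : ℝ, 1 ≤ x → e x ≤ 1 / 6)

include hnn hF hsmall in
/-- Under `e ≤ 1/6` the near shadow is flat on `[0, 5/7]`: `F(u) = 2`. -/
theorem F_eq_two {u : ℝ} (hu0 : 0 ≤ u) (hu : u ≤ 5 / 7) : F u = 2 := by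
  rw [F_near hnn hF (by linarith)]
  obtain ⟨hw1, -, -⟩ := near_arg hu0 (by linarith)
  have h := hsmall _ hw1
  have : (1 + u) / 2 * e (2 / (1 + u)) ≤ (1 + u) / 2 * (1 / 6) :=
    mul_le_mul_of_nonneg_left h (by linarith)
  exact max_eq_left (by linarith)

include hconv hanti hnn hcube hF hW hsmall

/-- Pencil bounds under `e ≤ 1/6`: near `W(1,x,1) ≤ max(2, (3+x)/2 + (1+x)/12)`, far `W(1,x,1) ≤ x + 7/6`. -/
theorem pencil_le :
    (∀ x : ℝ, 0 < x → x ≤ 1 → W 1 x 1 ≤ max 2 ((3 + x) / 2 + (1 + x) / 12)) ∧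
    (∀ x : ℝ, 1 ≤ x → W 1 x 1 ≤ x + 1 + 1 / 6) := by
  have R := foldShadow_realises hconv hanti hnn hcube hF hW
  refine ⟨fun x hx hx1 => ?_, fun x hx => ?_⟩
  · rw [R.2.2.2.2.2.2.1 x hx hx1]
    obtain ⟨hw1, -, -⟩ := near_arg hx.le hx1
    have h := hsmall _ hw1
    have : (1 + x) / 2 * e (2 / (1 + x)) ≤ (1 + x) / 2 * (1 / 6) :=
      mul_le_mul_of_nonneg_left h (by linarith)
    exact max_le_max le_rfl (by linarith)
  · rw [R.2.2.2.2.2.1 x hx]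
    linarith [hsmall x hx]

/-- COMPATIBILITY (a): every row of the VXXZ/Le Gall table `ω(1,κ,1) ≤ b` holds for `W_F`. -/
theorem foldShadow_table : ∀ κ b : ℝ, (κ, b) ∈ vxxz2024Table → W 1 κ 1 ≤ b := by
  obtain ⟨hN, hR⟩ := pencil_le hconv hanti hnn hcube hF hW hsmall
  intro κ b h
  simp only [vxxz2024Table, List.mem_cons, Prod.mk.injEq, List.not_mem_nil, or_false] at h
  rcases h with ⟨rfl, rfl⟩ | ⟨rfl, rfl⟩ | ⟨rfl, rfl⟩ | ⟨rfl, rfl⟩ | ⟨rfl, rfl⟩ | ⟨rfl, rfl⟩ |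
    ⟨rfl, rfl⟩ | ⟨rfl, rfl⟩ | ⟨rfl, rfl⟩ | ⟨rfl, rfl⟩ | ⟨rfl, rfl⟩ | ⟨rfl, rfl⟩ | ⟨rfl, rfl⟩ |
    ⟨rfl, rfl⟩ | ⟨rfl, rfl⟩ | ⟨rfl, rfl⟩ | ⟨rfl, rfl⟩ | ⟨rfl, rfl⟩ | ⟨rfl, rfl⟩ | ⟨rfl, rfl⟩ |
    ⟨rfl, rfl⟩ | ⟨rfl, rfl⟩ | ⟨rfl, rfl⟩ | ⟨rfl, rfl⟩
  iterate 18 exact (hN _ (by norm_num) (by norm_num)).trans (max_le (by norm_num) (by norm_num))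
  all_goals exact (hR _ (by norm_num)).trans (by norm_num)

omit hconv hanti hcube in
/-- COMPATIBILITY (b): the exact value `W(1,1/3,5/3) = 8/3` (`= ω(1,1/3,5/3)`): the slot through `F(1/4) = 2`
attains it, the other two slots stay below. -/
theorem foldShadow_eightThirds : W 1 (1 / 3) (5 / 3) = 8 / 3 := by
  have hq : F (2 * (1 / 3) / (1 + 5 / 3)) = 2 := by
    rw [show (2 * (1 / 3) / (1 + 5 / 3) : ℝ) = 1 / 4 by norm_num]
    exact F_eq_two hnn hF hsmall (by norm_num) (by norm_num)
  have h52 : F (2 * (5 / 3) / (1 + 1 / 3)) = 5 / 2 + 1 + e (5 / 2) := by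
    rw [show (2 * (5 / 3) / (1 + 1 / 3) : ℝ) = 5 / 2 by norm_num]
    exact F_far hF (by norm_num)
  have h1 : F (2 * 1 / (1 / 3 + 5 / 3)) = 1 + 1 + e 1 := by
    rw [show (2 * 1 / (1 / 3 + 5 / 3) : ℝ) = 1 by norm_num]
    exact F_far hF le_rfl
  have e52 := hsmall (5 / 2) (by norm_num)
  have e1 := hsmall 1 le_rfl
  rw [hW, hq, h52, h1, show (1 + 5 / 3 : ℝ) / 2 * 2 = 8 / 3 by norm_num]
  exact max_eq_left (max_le (by linarith) (by linarith))

omit hconv hcube hW in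
/-- COMPATIBILITY (c): Coppersmith tight shapes `∀ t ∈ [0,1) ∃ r ≥ 1, W(1,t,r) = 1+r`, with the `t`-dependent
length `r = max(4, x₀(1+t)/2)` where `e(x₀) < (1−t)/(1+t)` — this is exactly where `inf e = 0` is needed. -/
theorem foldShadow_tight (hW : ∀ a b c : ℝ, W a b c = max ((a + c) / 2 * F (2 * b / (a + c)))
      (max ((a + b) / 2 * F (2 * c / (a + b))) ((b + c) / 2 * F (2 * a / (b + c)))))
    (hvan : ∀ ε : ℝ, 0 < ε → ∃ x : ℝ, 1 ≤ x ∧ e x < ε) :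
    ∀ t : ℝ, 0 ≤ t → t < 1 → ∃ r : ℝ, 1 ≤ r ∧ W 1 t r = 1 + r := by
  intro t ht0 ht1
  have hpt : 0 < 1 + t := by linarith
  obtain ⟨x₀, hx₀, hex⟩ := hvan ((1 - t) / (1 + t)) (div_pos (by linarith) hpt)
  refine ⟨max 4 (x₀ * (1 + t) / 2), le_trans (by norm_num) (le_max_left _ _), ?_⟩
  set r := max 4 (x₀ * (1 + t) / 2) with hr
  have hr4 : 4 ≤ r := le_max_left _ _
  have hrx : x₀ * (1 + t) / 2 ≤ r := le_max_right _ _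
  have hu0 : 0 ≤ 2 * t / (1 + r) := by positivity
  have hu : 2 * t / (1 + r) ≤ 5 / 7 := by rw [div_le_iff₀ (by linarith)]; nlinarith
  have s1 : (1 + r) / 2 * F (2 * t / (1 + r)) = 1 + r := by
    rw [F_eq_two hnn hF hsmall hu0 hu]; ring
  have hv1 : 1 ≤ 2 * r / (1 + t) := by rw [le_div_iff₀ hpt]; linarith
  have hvx : x₀ ≤ 2 * r / (1 + t) := by rw [le_div_iff₀ hpt]; linarith
  have hev := hanti (mem_Ici.2 hx₀) (mem_Ici.2 (hx₀.trans hvx)) hvx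
  have s2 : (1 + t) / 2 * F (2 * r / (1 + t)) ≤ 1 + r := by
    rw [F_far hF hv1]
    have hid : (1 + t) / 2 * (2 * r / (1 + t) + 1 + e (2 * r / (1 + t))) =
        r + (1 + t) / 2 * (1 + e (2 * r / (1 + t))) := by
      field_simp
      ring
    rw [hid]
    have h1 : e (2 * r / (1 + t)) < (1 - t) / (1 + t) := lt_of_le_of_lt hev hex
    have h2 := (lt_div_iff₀ hpt).1 h1
    nlinarith [h2]
  have hw0 : 0 ≤ 2 * 1 / (t + r) := by positivity
  have hw : 2 * 1 / (t + r) ≤ 5 / 7 := by rw [div_le_iff₀ (by linarith)]; linarith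
  have s3 : (t + r) / 2 * F (2 * 1 / (t + r)) ≤ 1 + r := by
    rw [F_eq_two hnn hF hsmall hw0 hw]; linarith
  rw [hW, s1]
  exact max_eq_left (max_le s2 s3)

omit hsmall in
/-- COMPATIBILITY (d): the landed far-edge rate `LogRate` (`ω(1,k,1) ≤ k+1+log 2/log(2k+2)`) holds for
`W_F` iff the tail obeys it — a genuine extra constraint on slow tails (not implied by `e ≤ 1/6`). -/
theorem foldShadow_logRate (hlog : ∀ k : ℕ, 1 ≤ k → e k ≤ Real.log 2 / Real.log (2 * k + 2)) :
    ∀ k : ℕ, 1 ≤ k → W 1 k 1 ≤ k + 1 + Real.log 2 / Real.log (2 * k + 2) := by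
  intro k hk
  have hk' : (1 : ℝ) ≤ k := by exact_mod_cast hk
  rw [(foldShadow_realises hconv hanti hnn hcube hF hW).2.2.2.2.2.1 k hk']
  linarith [hlog k hk]

end Compat

/-! ## §4 The power family `e(x) = c·x^{−δ}`: free iff `c(1+3δ) ≤ 1` -/

/-- Bernoulli for negative real powers: `1 − x^{−δ} ≤ δ(x−1)` for `x ≥ 1`, `δ ≥ 0`
(`x^{−δ} = exp(−δ log x) ≥ 1 − δ log x ≥ 1 − δ(x−1)`). -/
theorem one_sub_rpow_neg_le {δ : ℝ} (hδ : 0 ≤ δ) {x : ℝ} (hx : 1 ≤ x) : 1 - x ^ (-δ) ≤ δ * (x - 1) := by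
  have hx0 : 0 < x := by linarith
  rw [Real.rpow_def_of_pos hx0]
  have h1 := Real.add_one_le_exp (Real.log x * (-δ))
  have h2 := mul_le_mul_of_nonneg_left (Real.log_le_sub_one_of_pos hx0) hδ
  nlinarith [h1, h2]

section Power

variable {c δ : ℝ} (hδ : 0 < δ) (hc : 0 ≤ c) (hcδ : c * (1 + 3 * δ) ≤ 1)
include hδ hc hcδ

/-- ★ The power tail `c·x^{−δ}` is FREE: convex (HLP §3.5), antitone, nonnegative, and cube-line coupled —
the coupling `c(1+3δ) ≤ 1` is exactly `e(1) + 3|e'(1)| ≤ 1` (Bernoulli).  (`e(1)` kept as `c·1^{−δ}`.) -/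
theorem power_free :
    ConvexOn ℝ (Ici 1) (fun x : ℝ => c * x ^ (-δ)) ∧ AntitoneOn (fun x : ℝ => c * x ^ (-δ)) (Ici 1) ∧
    (∀ x : ℝ, 1 ≤ x → 0 ≤ c * x ^ (-δ)) ∧
    (∀ x : ℝ, 1 ≤ x → c * (1 : ℝ) ^ (-δ) - c * x ^ (-δ) ≤ (1 - c * (1 : ℝ) ^ (-δ)) / 3 * (x - 1)) := by
  refine ⟨?_, ?_, fun x hx => mul_nonneg hc (Real.rpow_nonneg (by linarith) _), fun x hx => ?_⟩
  · have h := (Literature.NumberTheory.LFunctions.LTruncation.convexOn_rpow_neg hδ.le).subset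
      (fun x (hx : (1 : ℝ) ≤ x) => show (0 : ℝ) < x by linarith) (convex_Ici 1)
    refine ⟨convex_Ici 1, fun x hx y hy a b ha hb hab => ?_⟩
    have h' := h.2 hx hy ha hb hab
    simp only [smul_eq_mul] at h' ⊢
    nlinarith [mul_le_mul_of_nonneg_left h' hc]
  · intro x hx y hy hxy
    exact mul_le_mul_of_nonneg_left
      (Real.rpow_le_rpow_of_nonpos (by linarith [mem_Ici.1 hx]) hxy (by linarith)) hc
  · rw [Real.one_rpow]
    have h1 : c * (1 - x ^ (-δ)) ≤ c * (δ * (x - 1)) :=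
      mul_le_mul_of_nonneg_left (one_sub_rpow_neg_le hδ.le hx) hc
    have h2 : c * δ * (x - 1) ≤ (1 - c) / 3 * (x - 1) :=
      mul_le_mul_of_nonneg_right (by linarith) (by linarith)
    nlinarith [h1, h2]

variable {F : ℝ → ℝ} {W : ℝ → ℝ → ℝ → ℝ}
  (hF : ∀ x : ℝ, F x = if 1 ≤ x then x + 1 + c * x ^ (-δ)
    else max 2 ((3 + x) / 2 + (1 + x) / 2 * (c * (2 / (1 + x)) ^ (-δ))))
  (hW : ∀ a b c : ℝ, W a b c = max ((a + c) / 2 * F (2 * b / (a + c)))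
    (max ((a + b) / 2 * F (2 * c / (a + b))) ((b + c) / 2 * F (2 * a / (b + c)))))
include hF hW

/-- ★ THE POWER WORLD `W_{c,δ}` (fold-shadow perspective world of `c·x^{−δ}`, `c(1+3δ) ≤ 1`) is 3D-LAWFUL —
symmetric, homogeneous, subadditive, monotone, sandwiched — with far pencil EXACTLY `x + 1 + c·x^{−δ}`
(`x ≥ 1`) and `ω_W = W(1,1,1) = 2 + c`. -/
theorem powerWorld :
    (∀ a b c : ℝ, W a b c = W b a c ∧ W a b c = W a c b) ∧
    (∀ ν : ℝ, 0 < ν → ∀ a b c : ℝ, 0 < a → 0 < b → 0 < c → W (ν * a) (ν * b) (ν * c) = ν * W a b c) ∧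
    (∀ a b c a' b' c' : ℝ, 0 < a → 0 < b → 0 < c → 0 < a' → 0 < b' → 0 < c' →
      W (a + a') (b + b') (c + c') ≤ W a b c + W a' b' c') ∧
    (∀ a b b' c : ℝ, 0 < a → 0 < b → b ≤ b' → 0 < c → W a b c ≤ W a b' c) ∧
    (∀ a b c : ℝ, 0 < a → 0 < b → 0 < c → max (a + c) (max (a + b) (b + c)) ≤ W a b c ∧ W a b c ≤ a + b + c) ∧
    (∀ x : ℝ, 1 ≤ x → W 1 x 1 = x + 1 + c * x ^ (-δ)) ∧ W 1 1 1 = 2 + c := by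
  obtain ⟨h1, h2, h3, h4⟩ := power_free hδ hc hcδ
  have R := foldShadow_realises (e := fun x : ℝ => c * x ^ (-δ)) h1 h2 h3 h4 hF hW
  refine ⟨R.1, R.2.1, R.2.2.1, R.2.2.2.1, R.2.2.2.2.1, R.2.2.2.2.2.1, ?_⟩
  have h := R.2.2.2.2.2.2.2
  simp only [Real.one_rpow, mul_one] at h
  exact h

/-- THEOREM-COMPATIBILITY of the power world for `c ≤ 1/6` (every `δ > 0`): VXXZ table, `8/3`, tight shapes. -/
theorem powerWorld_compat (hc6 : c ≤ 1 / 6) :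
    (∀ κ b : ℝ, (κ, b) ∈ vxxz2024Table → W 1 κ 1 ≤ b) ∧ W 1 (1 / 3) (5 / 3) = 8 / 3 ∧
    (∀ t : ℝ, 0 ≤ t → t < 1 → ∃ r : ℝ, 1 ≤ r ∧ W 1 t r = 1 + r) := by
  obtain ⟨h1, h2, h3, h4⟩ := power_free hδ hc hcδ
  have hsmall : ∀ x : ℝ, 1 ≤ x → c * x ^ (-δ) ≤ 1 / 6 := fun x hx =>
    (mul_le_mul_of_nonneg_left (Real.rpow_le_one_of_one_le_of_nonpos hx (by linarith)) hc).trans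
      (by linarith)
  have hvan : ∀ ε : ℝ, 0 < ε → ∃ x : ℝ, 1 ≤ x ∧ c * x ^ (-δ) < ε := by
    intro ε hε
    have ht : Tendsto (fun x : ℝ => c * x ^ (-δ)) atTop (𝓝 (c * 0)) :=
      (tendsto_rpow_neg_atTop hδ).const_mul c
    rw [mul_zero] at ht
    obtain ⟨x, hx⟩ := ((ht.eventually (gt_mem_nhds hε)).and (eventually_ge_atTop 1)).exists
    exact ⟨x, hx.2, hx.1⟩
  exact ⟨foldShadow_table (e := fun x : ℝ => c * x ^ (-δ)) h1 h2 h3 h4 hF hW hsmall,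
    foldShadow_eightThirds (e := fun x : ℝ => c * x ^ (-δ)) h3 hF hW hsmall,
    foldShadow_tight (e := fun x : ℝ => c * x ^ (-δ)) h2 h3 hF hsmall hW hvan⟩

/-- `LogRate`-COMPATIBILITY of the power world under `c·(1 + 2δ·log 2) ≤ δ·log 2` (`log(2k+2) ≤ 2 log 2 + log k`
and `log k ≤ (k^δ − 1)/δ`): for slow tails the landed rate theorem is a real constraint on `c`. -/
theorem powerWorld_logRate (hcl : c * (1 + 2 * δ * Real.log 2) ≤ δ * Real.log 2) :
    ∀ k : ℕ, 1 ≤ k → W 1 k 1 ≤ k + 1 + Real.log 2 / Real.log (2 * k + 2) := by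
  obtain ⟨h1, h2, h3, h4⟩ := power_free hδ hc hcδ
  refine foldShadow_logRate (e := fun x : ℝ => c * x ^ (-δ)) h1 h2 h3 h4 hF hW fun k hk => ?_
  have hk' : (1 : ℝ) ≤ k := by exact_mod_cast hk
  have hk0 : (0 : ℝ) < k := by linarith
  have hl2 : 0 < Real.log 2 := Real.log_pos (by norm_num)
  have hL : 0 < Real.log (2 * k + 2) := Real.log_pos (by linarith)
  show c * (k : ℝ) ^ (-δ) ≤ Real.log 2 / Real.log (2 * k + 2)
  rw [le_div_iff₀ hL]
  -- log(2k+2) ≤ log(4k) = 2 log 2 + log k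
  have hlog4 : Real.log (2 * k + 2) ≤ 2 * Real.log 2 + Real.log k := by
    have h : Real.log (2 * k + 2) ≤ Real.log (4 * k) :=
      Real.log_le_log (by linarith) (by linarith)
    have h4 : Real.log (4 * k) = Real.log 4 + Real.log k :=
      Real.log_mul (by norm_num) hk0.ne'
    have h44 : Real.log 4 = 2 * Real.log 2 := by
      rw [show (4 : ℝ) = 2 ^ 2 by norm_num, Real.log_pow]; ring
    linarith
  -- log k ≤ (k^δ − 1)/δ
  have hkδ : 0 < (k : ℝ) ^ δ := Real.rpow_pos_of_pos hk0 δ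
  have hkδ1 : 1 ≤ (k : ℝ) ^ δ := Real.one_le_rpow hk' hδ.le
  have hlogk : δ * Real.log k ≤ (k : ℝ) ^ δ - 1 := by
    have := Real.log_le_sub_one_of_pos hkδ
    rw [Real.log_rpow hk0] at this
    exact this
  have hinv : (k : ℝ) ^ (-δ) * (k : ℝ) ^ δ = 1 := by
    rw [Real.rpow_neg hk0.le, inv_mul_cancel₀ hkδ.ne']
  have hneg0 : 0 ≤ (k : ℝ) ^ (-δ) := Real.rpow_nonneg hk0.le _
  -- c k^{-δ} log(2k+2) ≤ c k^{-δ} (2 log 2 + (k^δ-1)/δ) ≤ c (2 log 2 + 1/δ) ≤ log 2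
  have step1 : c * (k : ℝ) ^ (-δ) * Real.log (2 * k + 2) ≤
      c * (k : ℝ) ^ (-δ) * (2 * Real.log 2 * (k : ℝ) ^ δ + (k : ℝ) ^ δ / δ) := by
    apply mul_le_mul_of_nonneg_left _ (mul_nonneg hc hneg0)
    have ha : 2 * Real.log 2 ≤ 2 * Real.log 2 * (k : ℝ) ^ δ := by nlinarith
    have hb : Real.log k ≤ (k : ℝ) ^ δ / δ := by
      rw [le_div_iff₀ hδ]; linarith
    linarith
  have step2 : c * (k : ℝ) ^ (-δ) * (2 * Real.log 2 * (k : ℝ) ^ δ + (k : ℝ) ^ δ / δ) =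
      c * (2 * Real.log 2 + 1 / δ) := by
    have : c * (k : ℝ) ^ (-δ) * (2 * Real.log 2 * (k : ℝ) ^ δ + (k : ℝ) ^ δ / δ) =
        c * ((k : ℝ) ^ (-δ) * (k : ℝ) ^ δ) * (2 * Real.log 2 + 1 / δ) := by ring
    rw [this, hinv, mul_one]
  have step3 : c * (2 * Real.log 2 + 1 / δ) ≤ Real.log 2 := by
    rw [show c * (2 * Real.log 2 + 1 / δ) = c * (1 + 2 * δ * Real.log 2) / δ by field_simp; ring,
      div_le_iff₀ hδ]
    linarith
  linarith [step1, step2, step3]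

/-- LEAF SHAPES of the power world (`c > 0`): no saturated square shape (`¬FiniteSaturation`-shape, indeed
`W(1,k,1) > k+1` for all `k ≥ 1`), `PowerAmortisation`-shape with exponent exactly `δ` and constant `c`, and
`AnchoredLogConvexity`-shape (`c²m^{−2δ} ≤ c·c(2m−1)^{−δ} ⟺ 2m−1 ≤ m²`).  With `powerWorld_compat`: for every
`δ > 0` a 3D-lawful, theorem-compatible world of `ALC ∧ PA(δ) ∧ ¬FS ∧ ¬S` — the special leaf is load-bearing
at every rung of the power ladder. -/
theorem powerWorld_shapes (hc0 : 0 < c) :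
    (∀ k : ℕ, 1 ≤ k → (k : ℝ) + 1 < W 1 k 1) ∧
    (∀ k : ℕ, 1 ≤ k → W 1 k 1 - (k + 1) ≤ c * (k : ℝ) ^ (-δ)) ∧
    (∀ m : ℝ, 1 < m → (W 1 m 1 - (m + 1)) ^ 2 ≤ (W 1 1 1 - 2) * (W 1 (2 * m - 1) 1 - 2 * m)) := by
  have R := powerWorld hδ hc hcδ hF hW
  have far := R.2.2.2.2.2.1
  refine ⟨fun k hk => ?_, fun k hk => ?_, fun m hm => ?_⟩
  · have hk' : (1 : ℝ) ≤ k := by exact_mod_cast hk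
    rw [far k hk']
    have : 0 < (k : ℝ) ^ (-δ) := Real.rpow_pos_of_pos (by linarith) _
    nlinarith
  · have hk' : (1 : ℝ) ≤ k := by exact_mod_cast hk
    rw [far k hk']
    linarith
  · have hm0 : 0 ≤ m := by linarith
    rw [far m hm.le, far (2 * m - 1) (by linarith), R.2.2.2.2.2.2]
    have hsq : (c * m ^ (-δ)) ^ 2 = c * (c * (m ^ 2) ^ (-δ)) := by
      have h : (m ^ (-δ)) ^ 2 = (m ^ 2) ^ (-δ) := by
        rw [← Real.rpow_two, ← Real.rpow_mul hm0, ← Real.rpow_two, ← Real.rpow_mul hm0]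
        ring_nf
      rw [mul_pow, h]; ring
    have hle : (m ^ 2) ^ (-δ) ≤ (2 * m - 1) ^ (-δ) :=
      Real.rpow_le_rpow_of_nonpos (by linarith) (by nlinarith) (by linarith)
    have e1 : m + 1 + c * m ^ (-δ) - (m + 1) = c * m ^ (-δ) := by ring
    have e2 : (2 + c - 2) * (2 * m - 1 + 1 + c * (2 * m - 1) ^ (-δ) - 2 * m) =
        c * (c * (2 * m - 1) ^ (-δ)) := by ring
    rw [e1, e2, hsq]
    exact mul_le_mul_of_nonneg_left (mul_le_mul_of_nonneg_left hle hc) hc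

end Power

end Summit.MatrixMultiplication.MatrixMultiplication.Theorems.FarEdgeDescentTailWorlds
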